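import Summits.Schanuel.Schanuel.Theorems.EPiSimultaneousType.Negative.NegExponentFalse
import Mathlib.NumberTheory.Transcendental.Liouville.LiouvilleNumber

/-!
# `EPiSimultaneousType`: no measure of the crux's shape at a Liouville point — the statement is
about the arithmetic of `(π, e)`, not about transcendence (negative lemma for crux `stmt-Schanuel-6118`)

`epiSimultaneousType_false_at_liouvillePoint`: at `Λ = (L, L)`, `L = Σₖ 2^{−k!}` Liouville's
constant (transcendental), the measure of the crux
`Summit.Schanuel.Schanuel.Theses.DiophantineDichotomy.EPiSimultaneousType` — with `(π, e)` replaced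
by `Λ`, everything else verbatim — fails for EVERY `(a, b, C)` (not only `a < 1`, `C > 0`): the
rational points `(p/q, p/q)` with `|L − p/q| < q^{−n}` are admissible at level `d = 1` with
`log H ≤ log q + log(|L| + 2)` and beat `exp(−C(log H + 1))` once `n > C + C(log(|L|+2)+1)/log 2`.
Consequence `epiSimultaneousType_shape_not_uniform`: the uniform-in-the-point strengthening ("such
a measure at every point of `ℂ²` with transcendental coordinates") is false, so any proof of the
crux must use Diophantine input specific to `π` and `e`. (`(L, L)` has transcendence degree 1; an
algebraically independent bad pair is classical but not certifiable in Mathlib today.)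

Everything is proved; no named facts; cdisprove seat, Disproof.lean §2 (rational-point helpers reused from
`Negative/NegExponentFalse.lean`).
-/

set_option linter.dupNamespace false

noncomputable section

namespace Summit.Schanuel.Schanuel.Theorems

open Polynomial

namespace EPiSimultaneousType

/-- Liouville's constant is transcendental over `ℚ` as a complex number. [folklore] -/
theorem transcendental_liouvilleNumber_two_complex :
    Transcendental ℚ ((liouvilleNumber 2 : ℝ) : ℂ) := by
  have h1 : Transcendental ℤ (liouvilleNumber 2) := transcendental_liouvilleNumber (by norm_num)
  have h2 : Transcendental ℤ (algebraMap ℝ ℂ (liouvilleNumber 2)) :=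
    (transcendental_algebraMap_iff (R := ℤ) (S := ℝ) (A := ℂ) Complex.ofReal_injective).mpr h1
  exact fun h => h2 ((IsFractionRing.isAlgebraic_iff ℤ ℚ ℂ).mpr h)

end EPiSimultaneousType

open EPiSimultaneousType

/-- **No measure of the shape of `EPiSimultaneousType` holds at the Liouville point `(L, L)`**, for
ANY real `(a, b, C)`. [folklore] -/
theorem epiSimultaneousType_false_at_liouvillePoint (a b C : ℝ) :
    ¬ ∀ (d H : ℕ) (γ : Fin 2 → ℂ),
      Module.finrank ℚ ↥(IntermediateField.adjoin ℚ (Set.range γ)) ≤ d →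
      (∀ i, ∃ P : Polynomial ℤ, P ≠ 0 ∧ P.natDegree ≤ d ∧ (∀ k, |P.coeff k| ≤ (H : ℤ)) ∧
        Polynomial.aeval (γ i) P = 0) →
      Real.exp (-(C * ((d : ℝ) ^ a * Real.log H + (d : ℝ) ^ b))) ≤
        ‖γ - ![((liouvilleNumber 2 : ℝ) : ℂ), ((liouvilleNumber 2 : ℝ) : ℂ)]‖ := by
  intro hM
  set L : ℝ := liouvilleNumber 2 with hLdef
  have hLiou : Liouville L := liouville_liouvilleNumber (by norm_num)
  set K : ℝ := C * (Real.log (|L| + 2) + 1) with hK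
  obtain ⟨n, hn⟩ : ∃ n : ℕ, C + K / Real.log 2 < n := exists_nat_gt _
  obtain ⟨p, q, hq1, -, hpq⟩ := hLiou (n + 1)
  have hq0 : (0 : ℝ) < q := by exact_mod_cast (zero_lt_one.trans hq1)
  have hq1' : (1 : ℝ) < q := by exact_mod_cast hq1
  have hq2 : (2 : ℝ) ≤ q := by exact_mod_cast hq1
  lift q to ℕ using (zero_le_one.trans hq1.le) with N hN
  push_cast at hpq hq0 hq1' hq2 hq1
  have hN1 : 1 ≤ N := by exact_mod_cast hq1.le
  set H : ℕ := ⌈(|L| + 1) * N⌉₊ with hH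
  have hHreal : (|L| + 1) * N ≤ (H : ℝ) := Nat.le_ceil _
  have hHup : (H : ℝ) ≤ (|L| + 2) * N := by
    have := Nat.ceil_lt_add_one (show 0 ≤ (|L| + 1) * N by positivity)
    have hN1' : (1 : ℝ) ≤ N := by exact_mod_cast hN1
    rw [hH]; nlinarith
  have hdist1 : |L - p / N| < 1 := by
    refine hpq.trans_le ?_
    rw [div_le_one (by positivity)]
    exact one_le_pow₀ hq1'.le
  have hp_bound : |(p : ℝ)| ≤ (|L| + 1) * N := by
    have h1 : |(p : ℝ) / N| ≤ |L| + 1 := by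
      have := abs_sub_abs_le_abs_sub (p / N : ℝ) L
      rw [abs_sub_comm] at this
      linarith
    rwa [abs_div, abs_of_pos hq0, div_le_iff₀ hq0] at h1
  have hpH : |p| ≤ (H : ℤ) := by
    have : (|p| : ℝ) ≤ H := hp_bound.trans hHreal
    exact_mod_cast this
  have hNH : N ≤ H := by
    have : (N : ℝ) ≤ H := le_trans (by nlinarith [abs_nonneg L]) hHreal
    exact_mod_cast this
  set γ : Fin 2 → ℂ := fun i => ((![(p : ℚ) / N, (p : ℚ) / N] i : ℚ) : ℂ) with hγ
  have hcl : ∀ i, ∃ P : Polynomial ℤ, P ≠ 0 ∧ P.natDegree ≤ 1 ∧ (∀ k, |P.coeff k| ≤ (H : ℤ)) ∧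
      Polynomial.aeval (γ i) P = 0 := by
    have hz : ∀ i, γ i = (p : ℂ) / (N : ℂ) := by
      intro i; fin_cases i <;> simp [hγ]
    exact fun i => clause_of_eq_div hN1 le_rfl hpH hNH (hz i)
  have hmeas := hM 1 H γ (finrank_adjoin_ratCast _).le hcl
  have hnorm : ‖γ - ![((liouvilleNumber 2 : ℝ) : ℂ), ((liouvilleNumber 2 : ℝ) : ℂ)]‖ =
      |L - p / N| := by
    rw [norm_sub_eq_max]
    have e0 : ‖γ 0 - ![((liouvilleNumber 2 : ℝ) : ℂ), ((liouvilleNumber 2 : ℝ) : ℂ)] 0‖ =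
        |L - p / N| := by
      simp only [hγ, Matrix.cons_val_zero]
      rw [← Complex.ofReal_ratCast, ← Complex.ofReal_sub, Complex.norm_real, Real.norm_eq_abs,
        abs_sub_comm]
      push_cast
      rfl
    have e1 : ‖γ 1 - ![((liouvilleNumber 2 : ℝ) : ℂ), ((liouvilleNumber 2 : ℝ) : ℂ)] 1‖ =
        |L - p / N| := by
      simp only [hγ, Matrix.cons_val_one, Matrix.cons_val_zero]
      rw [← Complex.ofReal_ratCast, ← Complex.ofReal_sub, Complex.norm_real, Real.norm_eq_abs,
        abs_sub_comm]
      push_cast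
      rfl
    rw [e0, e1, max_self]
  rw [hnorm] at hmeas
  have hb : Real.exp (-(C * (((1 : ℕ) : ℝ) ^ a * Real.log H + ((1 : ℕ) : ℝ) ^ b))) =
      Real.exp (-(C * (Real.log H + 1))) := by simp
  rw [hb] at hmeas
  have hlt : |L - p / N| < Real.exp (-(((n + 1 : ℕ) : ℝ) * Real.log N)) := by
    refine hpq.trans_le (le_of_eq ?_)
    rw [Real.exp_neg, ← Real.log_pow, Real.exp_log (by positivity), one_div]
  have key : C * (Real.log H + 1) < ((n + 1 : ℕ) : ℝ) * Real.log N := by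
    have hlogN : Real.log 2 ≤ Real.log N := Real.log_le_log (by norm_num) hq2
    have hlog2 : 0 < Real.log 2 := Real.log_pos (by norm_num)
    have hn' : C + K / Real.log 2 < ((n + 1 : ℕ) : ℝ) := by push_cast; linarith
    rcases le_or_gt C 0 with hC | hC
    · have hH0 : 0 ≤ Real.log H := Real.log_natCast_nonneg H
      have : C * (Real.log H + 1) ≤ 0 := mul_nonpos_of_nonpos_of_nonneg hC (by linarith)
      have : 0 < ((n + 1 : ℕ) : ℝ) * Real.log N := mul_pos (by positivity) (hlog2.trans_le hlogN)
      linarith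
    · have hHpos : (0 : ℝ) < H := by
        have : (0 : ℝ) < (|L| + 1) * N := by positivity
        linarith
      have hlogH : Real.log H ≤ Real.log (|L| + 2) + Real.log N := by
        rw [← Real.log_mul (show (|L| + 2 : ℝ) ≠ 0 by positivity) hq0.ne']
        exact Real.log_le_log hHpos hHup
      have hKnn : 0 ≤ K := by
        rw [hK]
        have : 0 ≤ Real.log (|L| + 2) := Real.log_nonneg (by linarith [abs_nonneg L])
        positivity
      have h1 : K < (((n + 1 : ℕ) : ℝ) - C) * Real.log 2 := by
        have := (div_lt_iff₀ hlog2).mp (show K / Real.log 2 < ((n + 1 : ℕ) : ℝ) - C by linarith)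
        linarith
      have h2 : (((n + 1 : ℕ) : ℝ) - C) * Real.log 2 ≤ (((n + 1 : ℕ) : ℝ) - C) * Real.log N := by
        apply mul_le_mul_of_nonneg_left hlogN
        have : K / Real.log 2 ≥ 0 := by positivity
        linarith
      calc C * (Real.log H + 1) ≤ C * (Real.log (|L| + 2) + Real.log N + 1) := by gcongr
        _ = C * Real.log N + K := by rw [hK]; ring
        _ < C * Real.log N + (((n + 1 : ℕ) : ℝ) - C) * Real.log N := by linarith
        _ = ((n + 1 : ℕ) : ℝ) * Real.log N := by ring
  have : Real.exp (-(((n + 1 : ℕ) : ℝ) * Real.log N)) < Real.exp (-(C * (Real.log H + 1))) := by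
    rw [Real.exp_lt_exp]; linarith
  linarith

/-- **The shape of `EPiSimultaneousType` is not uniform in the point**: it fails at some point of
`ℂ²` with transcendental coordinates (the Liouville point), for every `(a, b, C)`. [folklore] -/
theorem epiSimultaneousType_shape_not_uniform :
    ¬ ∀ ϑ : Fin 2 → ℂ, (∀ i, Transcendental ℚ (ϑ i)) →
      ∃ a b C : ℝ, a < 1 ∧ 0 < C ∧ ∀ (d H : ℕ) (γ : Fin 2 → ℂ),
        Module.finrank ℚ ↥(IntermediateField.adjoin ℚ (Set.range γ)) ≤ d →
        (∀ i, ∃ P : Polynomial ℤ, P ≠ 0 ∧ P.natDegree ≤ d ∧ (∀ k, |P.coeff k| ≤ (H : ℤ)) ∧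
          Polynomial.aeval (γ i) P = 0) →
        Real.exp (-(C * ((d : ℝ) ^ a * Real.log H + (d : ℝ) ^ b))) ≤ ‖γ - ϑ‖ := by
  intro h
  obtain ⟨a, b, C, -, -, hM⟩ :=
    h ![((liouvilleNumber 2 : ℝ) : ℂ), ((liouvilleNumber 2 : ℝ) : ℂ)]
      (fun i => by fin_cases i <;> exact transcendental_liouvilleNumber_two_complex)
  exact epiSimultaneousType_false_at_liouvillePoint a b C hM

end Summit.Schanuel.Schanuel.Theorems

end
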